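import Summits.Ventures.PercRepro.C041ZoneReduction
import Summits.Ventures.PercRepro.C041BranchProduct

/-!
# The one-anchor zone as a product of branches: the BRANCH FACTORISATION and the BRANCH LEMMA, abstract level
(p6, gen 26; C-041.md §11 (b))

Pure counting, no graphs.  A zone with a single anchor `k` splits into BRANCHES `i : ι` (the components of `Z − k`);
a zone-state is a tuple of branch states `β i : B i`, and the branches interact only through `k`, by three readings of
a branch state: its ATTACHMENT TYPE `att` (the part of the branch blue-connected to `k` contributes a blue `1`-edge,
a blue `2`-edge, or nothing: `Att.one`, `Att.two`, `Att.free`), «blue at `K`» `blueK` (every terminal edge at the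
part red-connected to `k` is blue), and `good` (`G_i`: a red `2`-edge at a reachable vertex of that part; a
branch state blue at `K` is never good, `hbg`).  With `k` carrying no terminal edge, the zone sets of §11 read:

* `𝓛` (`Lzone`): every branch blue at `K`, no branch of type `two` (admissibility of `k`'s sub-zone), some branch of
  type `one` (the anchor deleted);
* `𝓡` (`Rzone`): no branch of type `one`, no good branch, some branch valid (= not blue at `K`).

THE IDENTITIES (`card_Lzone`, `card_Rzone`): with `a i = #{blueK ∧ one}`, `f i = #{blueK ∧ free}`,
`b i = #{blueK ∧ two}`, `V i = #{¬one ∧ ¬good ∧ ¬blueK}`,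
`#𝓛 = ∏ (a i + f i) − ∏ f i` and `#𝓡 = ∏ (V i + f i + b i) − ∏ (f i + b i)`; THE BRANCH LEMMA
(`card_Lzone_le_card_Rzone`): `∀ i, a i ≤ V i ⟹ #𝓛 ≤ #𝓡` (`C041BranchProduct.prod_add_sub_prod_le`).  The
case «`k` carries `1`-edges only» (`Lzone'`, `Rzone'`: `#𝓛 = ∏ (a i + f i)`, `#𝓡 = ∏ (V i + f i + b i)`) is
`card_Lzone'_le_card_Rzone'`.  The identification of a graph zone's `Lset` / `Rset` (`C041ZoneSplitDefs`) with this
model is NOT typed here.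
-/

namespace PercRepro

namespace BranchModel

open Finset

/-- The attachment type of a branch state: a blue `1`-edge, a blue `2`-edge, or none. -/
inductive Att
  | one
  | two
  | free
  deriving DecidableEq

/-- The readings of the branch states of the branch `i`. -/
structure Branch (β : Type*) where
  /-- the attachment type -/
  att : β → Att
  /-- «blue at `K`» -/
  blueK : β → Bool
  /-- `G_i` -/
  good : β → Bool

variable {ι : Type*} [Fintype ι] [DecidableEq ι] {B : ι → Type*} [∀ i, Fintype (B i)] [∀ i, DecidableEq (B i)]
  (br : ∀ i, Branch (B i))

/-- `a i`: the branch states blue at `K` of type `one`. -/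
def Aset (i : ι) : Finset (B i) := univ.filter fun x => (br i).blueK x = true ∧ (br i).att x = Att.one

/-- `f i`: the branch states blue at `K` of type `free`. -/
def Fset (i : ι) : Finset (B i) := univ.filter fun x => (br i).blueK x = true ∧ (br i).att x = Att.free

/-- `b i`: the branch states blue at `K` of type `two`. -/
def Bset (i : ι) : Finset (B i) := univ.filter fun x => (br i).blueK x = true ∧ (br i).att x = Att.two

/-- `V i`: the branch states not of type `one`, not good, and valid (not blue at `K`). -/
def Vset (i : ι) : Finset (B i) :=
  univ.filter fun x => (br i).att x ≠ Att.one ∧ (br i).good x = false ∧ (br i).blueK x = false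

/-- `f i + b i`: the branch states blue at `K` and not of type `one`. -/
def FBset (i : ι) : Finset (B i) := univ.filter fun x => (br i).blueK x = true ∧ (br i).att x ≠ Att.one

/-- `𝓛` for an anchor without terminal edges: every branch blue at `K`, none of type `two`, some of type `one`. -/
def Lzone : Finset (∀ i, B i) :=
  univ.filter fun β => (∀ i, (br i).blueK (β i) = true ∧ (br i).att (β i) ≠ Att.two) ∧
    ∃ i, (br i).att (β i) = Att.one

/-- `𝓡` for an anchor without terminal edges: no branch of type `one`, no good branch, some branch valid. -/
def Rzone : Finset (∀ i, B i) :=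
  univ.filter fun β => (∀ i, (br i).att (β i) ≠ Att.one ∧ (br i).good (β i) = false) ∧
    ∃ i, (br i).blueK (β i) = false

/-- `𝓛` for an anchor with `1`-edges only (all blue): every branch blue at `K`, none of type `two`. -/
def Lzone' : Finset (∀ i, B i) :=
  univ.filter fun β => ∀ i, (br i).blueK (β i) = true ∧ (br i).att (β i) ≠ Att.two

/-- `𝓡` for an anchor with `1`-edges only (all red): no branch of type `one`, no good branch. -/
def Rzone' : Finset (∀ i, B i) :=
  univ.filter fun β => ∀ i, (br i).att (β i) ≠ Att.one ∧ (br i).good (β i) = false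

/-- `𝓛 = mixed A F`. -/
theorem Lzone_eq : Lzone br = ZoneReduction.mixed (Aset br) (Fset br) := by
  ext β
  simp only [Lzone, ZoneReduction.mem_mixed, Aset, Fset, Finset.mem_filter, Finset.mem_univ, true_and,
    Finset.mem_union]
  constructor
  · rintro ⟨h1, i, hi⟩
    refine ⟨fun j => ?_, fun h => ?_⟩
    · obtain ⟨hb, hn⟩ := h1 j
      cases hj : (br j).att (β j)
      · exact Or.inl ⟨hb, rfl⟩
      · exact absurd hj hn
      · exact Or.inr ⟨hb, rfl⟩
    · rw [(h i).2] at hi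
      cases hi
  · rintro ⟨h1, h2⟩
    refine ⟨fun j => ?_, ?_⟩
    · rcases h1 j with ⟨hb, ha⟩ | ⟨hb, ha⟩
      · exact ⟨hb, by rw [ha]; decide⟩
      · exact ⟨hb, by rw [ha]; decide⟩
    · by_contra hne
      apply h2
      intro j
      rcases h1 j with ⟨hb, ha⟩ | h
      · exact absurd ⟨j, ha⟩ hne
      · exact h

/-- `𝓡 = mixed V (F ∪ B)`. -/
theorem Rzone_eq (hbg : ∀ i x, (br i).blueK x = true → (br i).good x = false) :
    Rzone br = ZoneReduction.mixed (Vset br) (FBset br) := by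
  ext β
  simp only [Rzone, ZoneReduction.mem_mixed, Vset, FBset, Finset.mem_filter, Finset.mem_univ, true_and,
    Finset.mem_union]
  constructor
  · rintro ⟨h1, i, hi⟩
    refine ⟨fun j => ?_, fun h => ?_⟩
    · obtain ⟨hn, hg⟩ := h1 j
      cases hb : (br j).blueK (β j)
      · exact Or.inl ⟨hn, hg, rfl⟩
      · exact Or.inr ⟨rfl, hn⟩
    · rw [(h i).1] at hi
      cases hi
  · rintro ⟨h1, h2⟩
    refine ⟨fun j => ?_, ?_⟩
    · rcases h1 j with ⟨hn, hg, _⟩ | ⟨hb, hn⟩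
      · exact ⟨hn, hg⟩
      · exact ⟨hn, hbg j _ hb⟩
    · by_contra hne
      apply h2
      intro j
      rcases h1 j with ⟨_, _, hb⟩ | h
      · exact absurd ⟨j, hb⟩ hne
      · exact h

omit [Fintype ι] [DecidableEq ι] in
/-- `#(F ∪ B) = f + b`: the two are disjoint and exhaust the states blue at `K` not of type `one`. -/
theorem card_FBset (i : ι) : (FBset br i).card = (Fset br i).card + (Bset br i).card := by
  rw [← Finset.card_union_of_disjoint]
  · congr 1
    ext x
    simp only [FBset, Fset, Bset, Finset.mem_filter, Finset.mem_univ, true_and, Finset.mem_union]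
    constructor
    · rintro ⟨hb, hn⟩
      cases h : (br i).att x
      · exact absurd h hn
      · exact Or.inr ⟨hb, rfl⟩
      · exact Or.inl ⟨hb, rfl⟩
    · rintro (⟨hb, h⟩ | ⟨hb, h⟩) <;> exact ⟨hb, by rw [h]; decide⟩
  · rw [Finset.disjoint_left]
    intro x hx hx'
    simp only [Fset, Bset, Finset.mem_filter, Finset.mem_univ, true_and] at hx hx'
    rw [hx.2] at hx'
    cases hx'.2

/-- **THE BRANCH FACTORISATION, left side** (C-041.md §11 (b)): `#𝓛 = ∏ (a i + f i) − ∏ f i`. -/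
theorem card_Lzone : (Lzone br).card = ∏ i, ((Aset br i).card + (Fset br i).card) - ∏ i, (Fset br i).card := by
  rw [Lzone_eq]
  apply ZoneReduction.card_mixed
  intro i
  rw [Finset.disjoint_left]
  intro x hx hx'
  simp only [Aset, Fset, Finset.mem_filter, Finset.mem_univ, true_and] at hx hx'
  rw [hx.2] at hx'
  cases hx'.2

/-- **THE BRANCH FACTORISATION, right side**: `#𝓡 = ∏ (V i + f i + b i) − ∏ (f i + b i)`. -/
theorem card_Rzone (hbg : ∀ i x, (br i).blueK x = true → (br i).good x = false) :
    (Rzone br).card = ∏ i, ((Vset br i).card + (Fset br i).card + (Bset br i).card)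
      - ∏ i, ((Fset br i).card + (Bset br i).card) := by
  rw [Rzone_eq br hbg, ZoneReduction.card_mixed]
  · simp only [card_FBset, add_assoc]
  · intro i
    rw [Finset.disjoint_left]
    intro x hx hx'
    simp only [Vset, FBset, Finset.mem_filter, Finset.mem_univ, true_and] at hx hx'
    rw [hx.2.2] at hx'
    cases hx'.1

/-- **THE BRANCH LEMMA** (C-041.md §11 (b)): `a i ≤ V i` for every branch gives `#𝓛 ≤ #𝓡`. -/
theorem card_Lzone_le_card_Rzone (hbg : ∀ i x, (br i).blueK x = true → (br i).good x = false)
    (h : ∀ i, (Aset br i).card ≤ (Vset br i).card) : (Lzone br).card ≤ (Rzone br).card := by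
  rw [card_Lzone, card_Rzone br hbg]
  exact BranchProduct.branch_lemma_edgeFree univ (fun i => (Aset br i).card) (fun i => (Fset br i).card)
    (fun i => (Bset br i).card) (fun i => (Vset br i).card) fun i _ => h i

/-- `𝓛' = piFinset (A ∪ F)`: `#𝓛' = ∏ (a i + f i)`. -/
theorem card_Lzone' : (Lzone' br).card = ∏ i, ((Aset br i).card + (Fset br i).card) := by
  have : Lzone' br = Fintype.piFinset fun i => Aset br i ∪ Fset br i := by
    ext β
    simp only [Lzone', Fintype.mem_piFinset, Aset, Fset, Finset.mem_filter, Finset.mem_univ, true_and,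
      Finset.mem_union]
    constructor
    · intro h j
      obtain ⟨hb, hn⟩ := h j
      cases hj : (br j).att (β j)
      · exact Or.inl ⟨hb, rfl⟩
      · exact absurd hj hn
      · exact Or.inr ⟨hb, rfl⟩
    · intro h j
      rcases h j with ⟨hb, ha⟩ | ⟨hb, ha⟩ <;> exact ⟨hb, by rw [ha]; decide⟩
  rw [this, Fintype.card_piFinset]
  apply Finset.prod_congr rfl
  intro i _
  apply Finset.card_union_of_disjoint
  rw [Finset.disjoint_left]
  intro x hx hx'
  simp only [Aset, Fset, Finset.mem_filter, Finset.mem_univ, true_and] at hx hx'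
  rw [hx.2] at hx'
  cases hx'.2

/-- `𝓡' = piFinset (V ∪ (F ∪ B))`: `#𝓡' = ∏ (V i + f i + b i)`. -/
theorem card_Rzone' (hbg : ∀ i x, (br i).blueK x = true → (br i).good x = false) :
    (Rzone' br).card = ∏ i, ((Vset br i).card + (Fset br i).card + (Bset br i).card) := by
  have : Rzone' br = Fintype.piFinset fun i => Vset br i ∪ FBset br i := by
    ext β
    simp only [Rzone', Fintype.mem_piFinset, Vset, FBset, Finset.mem_filter, Finset.mem_univ, true_and,
      Finset.mem_union]
    constructor
    · intro h j
      obtain ⟨hn, hg⟩ := h j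
      cases hb : (br j).blueK (β j)
      · exact Or.inl ⟨hn, hg, rfl⟩
      · exact Or.inr ⟨rfl, hn⟩
    · intro h j
      rcases h j with ⟨hn, hg, _⟩ | ⟨hb, hn⟩
      · exact ⟨hn, hg⟩
      · exact ⟨hn, hbg j _ hb⟩
  rw [this, Fintype.card_piFinset]
  apply Finset.prod_congr rfl
  intro i _
  rw [Finset.card_union_of_disjoint, card_FBset, add_assoc]
  rw [Finset.disjoint_left]
  intro x hx hx'
  simp only [Vset, FBset, Finset.mem_filter, Finset.mem_univ, true_and] at hx hx'
  rw [hx.2.2] at hx'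
  cases hx'.1

/-- **THE BRANCH LEMMA, anchor with `1`-edges only**: `a i ≤ V i` for every branch gives `#𝓛' ≤ #𝓡'`. -/
theorem card_Lzone'_le_card_Rzone' (hbg : ∀ i x, (br i).blueK x = true → (br i).good x = false)
    (h : ∀ i, (Aset br i).card ≤ (Vset br i).card) : (Lzone' br).card ≤ (Rzone' br).card := by
  rw [card_Lzone', card_Rzone' br hbg]
  exact BranchProduct.branch_lemma_oneEdges univ (fun i => (Aset br i).card) (fun i => (Fset br i).card)
    (fun i => (Bset br i).card) (fun i => (Vset br i).card) fun i _ => h i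

end BranchModel

end PercRepro
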